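import Summits.BirchSwinnertonDyer.Rank1Residual.X2.UnramifiedLineIntegral
import Summits.BirchSwinnertonDyer.Rank1Residual.X2.IsogenyClassStability
import Literature.NumberTheory.EllipticCurves.SemistableModPImageMultiplicativeProofs
import Literature.NumberTheory.EllipticCurves.OpenImageMazurRaynaudKummerProofs
import HarnessLib

/-!
# The inertia line at a MULTIPLICATIVE odd `p`, WITHOUT the Tate curve: it has order `p`, is moved by
# inertia, and consists of the `p`-torsion off the integral locus of the minimal model

HONEST FRAMING (cell `b2b-bsdres-*`, verbatim): the goal of the cell is to DELETE the
COMBINATION-SHAPED residual classes for ALL analytic-rank ≤ 1 curves over ℚ — "full BSD formula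
for every rank ≤ 1 curve in class C" assembled STRICTLY from published theorems — so that the
rank-≤1 remainder becomes exactly the CONSTRUCTION-SHAPED classes, which are TYPED (missing-input
Props), NOT attempted; this is not "finishing BSD". Off-peak literature typer `b2b-bsdres-lit-cgls`
(CGLS22 / GV00, the reducible = Eisenstein column), session 15, file 1 of 3: an ELEMENTARY REDUCTION
of the Eisenstein column at every MULTIPLICATIVE odd prime (class X2 / the O9, N9 sub-cells) —
theorems only, no definition, no named fact, nothing booked, no label changed.

WHY. The lane's decision procedure of record for `GVPar W p` (bsdN/HYPOTHESES.md row T-GV0: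
"ramified ⇔ the kernel polynomial `H` is not `p`-integral") is a kernel theorem at every GOOD
ORDINARY odd `p` since session 14 (`KernelDisc.lineUnramifiedAt_iff_valuation_le_one`, via the
reduction map `E[p] → Ẽ(𝔽̄_p)`). The class-closure typer's third engine KDISC-ODD
(HOME/class-closure/O9/KDISC-ODD-typer6.md) found the rational `p`-line UNRAMIFIED, from a
`p`-INTEGRAL kernel polynomial, on all 516 + 43 MULTIPLICATIVE O9 rows at `p = 5, 7`, where the tree
had only the forward half "unramified ⇒ integral"
(`X2.UnramifiedLineIntegral.valuation_le_one_of_lineUnramifiedAt_of_mult`, unit `eisenstein-p2`).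
This file supplies the LOCAL STRUCTURE needed for the converse (file 2,
`EisensteinKernelReductionLineMult`) and for the Greenberg–Vatsal type (file 3,
`EisensteinKernelTypeMultiplicative`) at a multiplicative odd `p`, with NO Tate uniformisation (the
named facts A40/A41 `hT`, `hT'` are not used):

* §1 the kernel of reduction `E₁` of the globally minimal model at the tree's place `𝔓` over `p`
  (Silverman *AEC* VII.2.1, tree `WeierstrassCurve.ReducesToZero` / `kernelOfReduction` over the
  valuation ring `placeOver p`): in coordinates (`v_𝔓(x) > 1`, `reducesToZero_place_iff_of_eq_some`),
  stable under `I_𝔓` (`reducesToZero_place_smul_iff`), a subgroup (`reducesToZero_place_sub`,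
  `reducesToZero_place_zsmul`) — valid at every prime;
* §2 **the inertia line, Tate-free.** Serre's shape `ρ̄|_{I_𝔓} = (χ *; 0 1)` at a multiplicative
  `v ∣ p` (Invent. Math. 15 (1972) §1.12, Cor. of Prop. 13; tree
  `WeierstrassCurve.exists_addSubgroup_card_le_of_hasMultiplicativeReductionAt`, proved on the Tate
  FORM of invariant `j`, not the Tate curve) gives `X ≤ E[p]`, `#X ≤ p`, `(τ - 1)E[p] ⊆ X`. With a
  `p`-torsion point `P₀ ∈ E₁` (height one at a nodal prime: tree
  `exists_prime_zsmul_eq_zero_one_lt_valuation_placeOver` with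
  `X2.UnramifiedLineIntegral.hasseCoeff_integralModelInt_ne_zero_of_mult`) and an inertia element `τ₀`
  moving it (`X2.UnramifiedLineIntegral.exists_inertia_smul_ne_of_prime_zsmul_eq_zero_of_one_lt`,
  Serre §1.11): `Q = τ₀P₀ - P₀ ∈ X ∩ E₁ ∖ 0`, so **`#X = p`, `X = ℤQ ⊆ E₁`, and `I_𝔓` moves a
  point of `X`** (`card_eq_and_reducesToZero_and_exists_smul_ne_of_inertiaLine`). Hence the cell's
  local input (hL) — "at every prime above `p` a line `L` of order `p` with `(σ - 1)E[p] ⊆ L` and a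
  point moved by inertia" — at a multiplicative odd `p` WITHOUT `hT`/`hT'`
  (**`exists_inertiaLine_of_mult`**; same conclusion as `X2.exists_tateLine`), and every non-zero
  point of an inertia line at the place's prime has non-`𝔓`-integral abscissa
  (`one_lt_valuation_of_mem_inertiaLine`: the canonical subgroup is off the integral locus).

References: J.-P. Serre, Invent. Math. 15 (1972) §1.11 (Prop. 11, Cor.), §1.12 (Prop. 13, Cor.)
[SerreInventiones1972]; R. Greenberg, V. Vatsal, Invent. Math. 142 (2000), §2 pp. 14–15 and p. 26
("`C[p] = μ_p`") [GreenbergVatsal2000]; J. H. Silverman, *AEC*, GTM 106 (2009), VII.2.1–2.2, VII.3.1,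
VII.5.1(b) [SilvermanAEC2009]; bsdN/HYPOTHESES.md row T-GV0; HOME/class-closure/O9/KDISC-ODD-typer6.md;
HOME/b2b-bsdres-lit-cgls/CGLS-GV-TYPING.md §22.
-/

set_option autoImplicit false

noncomputable section

open scoped Classical NumberField ComplexConjugate

open WeierstrassCurve Polynomial Literature.NumberTheory.EllipticCurves
  Literature.NumberTheory.EllipticCurves.Rank1Residual Literature.NumberTheory.GaloisRepresentations
  Field IsDedekindDomain NumberField Rat.HeightOneSpectrum

namespace Summit.BirchSwinnertonDyer.Rank1Residual

namespace KernelDisc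

variable {W : WeierstrassCurve ℚ} [W.IsElliptic] [W.IsGloballyMinimal] {p : ℕ} [Fact p.Prime]
  {Φ : AddSubgroup (geomTorsion W (p : ℤ))}
/-! ### §1. The kernel of reduction of the minimal model at the place `𝔓` -/

omit [W.IsElliptic] [W.IsGloballyMinimal] in
/-- The Galois action on an affine point of `E(ℚ̄)` is coordinatewise. [folklore] -/
private theorem smul_some_eq (σ : absoluteGaloisGroup ℚ) {x y : AlgebraicClosure ℚ}
    (h : (W.baseChange (AlgebraicClosure ℚ)).toAffine.Nonsingular x y) :
    ∃ h', σ • (show W.geomPoints from Affine.Point.some x y h) =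
      (show W.geomPoints from
        Affine.Point.some (absoluteGaloisGroup.toAlgEquiv ℚ σ x)
          (absoluteGaloisGroup.toAlgEquiv ℚ σ y) h') :=
  ⟨_, rfl⟩

omit [W.IsElliptic] [W.IsGloballyMinimal] in
/-- A non-zero point of `E(ℚ̄)` is an affine point `(x, y)`. [folklore] -/
theorem exists_eq_some_of_ne_zero {P : W.geomPoints} (hP : P ≠ 0) :
    ∃ (x y : AlgebraicClosure ℚ) (h : (W.baseChange (AlgebraicClosure ℚ)).toAffine.Nonsingular x y),
      P = Affine.Point.some x y h := by
  change (W.baseChange (AlgebraicClosure ℚ)).toAffine.Point at P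
  rcases P with _ | ⟨x, y, h⟩
  · exact absurd Affine.Point.zero_def hP
  · exact ⟨x, y, h, rfl⟩

omit [W.IsElliptic] in
/-- **The kernel of reduction in coordinates** (Silverman *AEC* VII.2.1) for the globally minimal
model read over the place `𝒪_𝔓 = placeOver p` of `ℚ̄`: the affine point `P = (x, y)` of `E(ℚ̄)`
lies in `E₁` (tree `WeierstrassCurve.ReducesToZero (placeModel p W)`, transported along
`E(ℚ̄) = W_𝒪(ℚ̄)`, `placeModel_baseChange`) iff `x ∉ 𝒪_𝔓`, i.e. `v_𝔓(x) > 1`. Valid at EVERY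
prime `p` (no reduction hypothesis). [cite: SilvermanAEC2009, VII.2 Prop. 2.1] -/
theorem reducesToZero_place_some_iff {x y : AlgebraicClosure ℚ}
    (h : (W.baseChange (AlgebraicClosure ℚ)).toAffine.Nonsingular x y) :
    WeierstrassCurve.ReducesToZero (placeModel p W)
        (Affine.Point.congrEquiv (placeModel_baseChange p W).symm (.some x y h : W.geomPoints)) ↔
      1 < (placeOver p).valuation x := by
  rw [Affine.Point.congrEquiv_some, WeierstrassCurve.reducesToZero_some_iff]
  exact not_mem_range_iff (integers_placeOver p)

omit [W.IsElliptic] in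
/-- The same for a point given with its coordinates `P = (x, y)`. [cite: SilvermanAEC2009, VII.2 Prop. 2.1] -/
theorem reducesToZero_place_iff_of_eq_some {P : W.geomPoints} {x y : AlgebraicClosure ℚ}
    {h : (W.baseChange (AlgebraicClosure ℚ)).toAffine.Nonsingular x y}
    (hP : P = Affine.Point.some x y h) :
    WeierstrassCurve.ReducesToZero (placeModel p W)
        (Affine.Point.congrEquiv (placeModel_baseChange p W).symm P) ↔
      1 < (placeOver p).valuation x := by
  subst hP
  exact reducesToZero_place_some_iff h

omit [W.IsElliptic] in
/-- **`E₁` is stable under the inertia group of the place's prime** (indeed under its decomposition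
group): for `σ ∈ I_𝔓`, `𝔓 = 𝔪_𝔓 ∩ \bar ℤ`, and an affine point `P`, `σP ∈ E₁ ↔ P ∈ E₁` — `I_𝔓`
stabilises `𝒪_𝔓` (tree `Mazur1978.smul_mem_placeOver_iff`) and acts coordinatewise.
[cite: SerreInventiones1972, §1.3] -/
theorem reducesToZero_place_smul_iff {𝔓 : Ideal (absIntegers (𝓞 ℚ) ℚ)}
    (hmem : ∀ z : absIntegers (𝓞 ℚ) ℚ, z ∈ 𝔓 ↔ (z : AlgebraicClosure ℚ) ∈ (placeOver p).nonunits)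
    {σ : absoluteGaloisGroup ℚ} (hσ : σ ∈ 𝔓.inertia (absoluteGaloisGroup ℚ))
    {P : W.geomPoints} {x y : AlgebraicClosure ℚ}
    {h : (W.baseChange (AlgebraicClosure ℚ)).toAffine.Nonsingular x y}
    (hP : P = Affine.Point.some x y h) :
    WeierstrassCurve.ReducesToZero (placeModel p W)
        (Affine.Point.congrEquiv (placeModel_baseChange p W).symm (σ • P)) ↔
      WeierstrassCurve.ReducesToZero (placeModel p W)
        (Affine.Point.congrEquiv (placeModel_baseChange p W).symm P) := by
  obtain ⟨h', hs⟩ := smul_some_eq (W := W) σ h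
  have hσP : σ • P = Affine.Point.some (absoluteGaloisGroup.toAlgEquiv ℚ σ x)
      (absoluteGaloisGroup.toAlgEquiv ℚ σ y) h' := by
    rw [hP]
    exact hs
  rw [reducesToZero_place_iff_of_eq_some hσP, reducesToZero_place_iff_of_eq_some hP, ← not_le,
    ← not_le, ValuationSubring.valuation_le_one_iff, ValuationSubring.valuation_le_one_iff]
  have key := Mazur1978.smul_mem_placeOver_iff hmem hσ x
  rw [Field.absoluteGaloisGroup.smul_def] at key
  rw [key]

omit [W.IsElliptic] in
/-- **`E₁` is a subgroup** (Silverman *AEC* VII.2.1–2.2, tree `ReducesToZero.sub` over the valuation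
ring `𝒪_𝔓`): differences of points of `E₁` lie in `E₁`. [cite: SilvermanAEC2009, VII.2 Prop. 2.1] -/
theorem reducesToZero_place_sub {P Q : (W.baseChange (AlgebraicClosure ℚ)).toAffine.Point}
    (hP : WeierstrassCurve.ReducesToZero (placeModel p W)
      (Affine.Point.congrEquiv (placeModel_baseChange p W).symm P))
    (hQ : WeierstrassCurve.ReducesToZero (placeModel p W)
      (Affine.Point.congrEquiv (placeModel_baseChange p W).symm Q)) :
    WeierstrassCurve.ReducesToZero (placeModel p W)
      (Affine.Point.congrEquiv (placeModel_baseChange p W).symm (P - Q)) := by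
  convert hP.sub (integers_placeOver p) hQ using 2
  exact map_sub _ _ _

omit [W.IsElliptic] in
/-- Multiples of a point of `E₁` lie in `E₁` (the kernel of reduction is a subgroup, tree
`WeierstrassCurve.kernelOfReduction`). [cite: SilvermanAEC2009, VII.2 Prop. 2.1] -/
theorem reducesToZero_place_zsmul {P : (W.baseChange (AlgebraicClosure ℚ)).toAffine.Point}
    (hP : WeierstrassCurve.ReducesToZero (placeModel p W)
      (Affine.Point.congrEquiv (placeModel_baseChange p W).symm P)) (m : ℤ) :
    WeierstrassCurve.ReducesToZero (placeModel p W)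
      (Affine.Point.congrEquiv (placeModel_baseChange p W).symm (m • P)) := by
  have key := (WeierstrassCurve.mem_kernelOfReduction_iff (integers_placeOver p)).mp
    ((WeierstrassCurve.kernelOfReduction (placeModel p W) (integers_placeOver p)).zsmul_mem
      ((WeierstrassCurve.mem_kernelOfReduction_iff (integers_placeOver p)).mpr hP) m)
  convert key using 2
  exact map_zsmul _ _ _

omit [W.IsGloballyMinimal] in
/-- Multiplicative reduction at the prime `p` is multiplicative reduction at the place `v ∋ p`
(Silverman *AEC* VII.5.1(b); tree
`hasMultiplicativeReductionAtPrime_iff_hasMultiplicativeReductionAt_ringOfIntegers`).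
[cite: SilvermanAEC2009, VII.5 Prop. 5.1(b)] -/
theorem hasMultiplicativeReductionAt_of_natCast_mem (hmult : W.HasMultiplicativeReductionAtPrime p)
    {v : HeightOneSpectrum (𝓞 ℚ)} (hv : (p : 𝓞 ℚ) ∈ v.asIdeal) :
    W.HasMultiplicativeReductionAt v := by
  have hp : p.Prime := Fact.out
  have hvp : (primesEquiv v : ℕ) = p := primesEquiv_eq_of_natCast_mem hp hv
  have h := W.hasMultiplicativeReductionAtPrime_iff_hasMultiplicativeReductionAt_ringOfIntegers v
  subst hvp
  exact h.mp hmult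

/-! ### §2. The inertia line at a multiplicative odd `p`, without the Tate curve -/

/-- **The inertia line at a multiplicative odd `p` is the non-integral `p`-torsion; it has order `p`
and is moved by inertia — Tate-free.** Let `E/ℚ` be given by a globally minimal `W` with
multiplicative reduction at the odd prime `p`, `𝔓` the prime of `\bar ℤ` under the tree's place
`placeOver p`, and `X ≤ E[p]` ANY subgroup with `#X ≤ p` receiving `τP - P` for all `τ ∈ I_𝔓`,
`P ∈ E[p]` (Serre's `(χ *; 0 1)` shape, tree
`exists_addSubgroup_card_le_of_hasMultiplicativeReductionAt`). Then `#X = p`, every point of `X`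
lies in the kernel of reduction `E₁` of the minimal model at `𝔓`, and some `σ ∈ I_𝔓` moves a point
of `X`. Proof: a `p`-torsion point `P₀ ∈ E₁` exists (height one at a nodal prime) and is moved by
some `τ₀ ∈ I_𝔓` (Serre §1.11); `Q = τ₀P₀ - P₀ ∈ X` is non-zero and lies in the SUBGROUP `E₁`
(`I_𝔓` stabilises `E₁`), so `X = ℤQ ⊆ E₁`; and `Q`, again off the integral locus, is moved.
[cite: SerreInventiones1972, §1.11 (Prop. 11, Cor.) and §1.12 (Cor. of Prop. 13)]
[cite: SilvermanAEC2009, VII.2 Prop. 2.1] -/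
theorem card_eq_and_reducesToZero_and_exists_smul_ne_of_inertiaLine (hp2 : p ≠ 2)
    (hmult : W.HasMultiplicativeReductionAtPrime p)
    {𝔓 : Ideal (absIntegers (𝓞 ℚ) ℚ)}
    (hmem : ∀ z : absIntegers (𝓞 ℚ) ℚ, z ∈ 𝔓 ↔ (z : AlgebraicClosure ℚ) ∈ (placeOver p).nonunits)
    {X : AddSubgroup (geomTorsion W (p : ℤ))} (hXcard : Nat.card X ≤ p)
    (hXsub : ∀ τ ∈ 𝔓.inertia (absoluteGaloisGroup ℚ), ∀ P : geomTorsion W (p : ℤ), τ • P - P ∈ X) :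
    Nat.card X = p ∧
      (∀ P ∈ X, WeierstrassCurve.ReducesToZero (placeModel p W)
        (Affine.Point.congrEquiv (placeModel_baseChange p W).symm (P : W.geomPoints))) ∧
      (∃ σ ∈ 𝔓.inertia (absoluteGaloisGroup ℚ), ∃ P ∈ X, σ • P ≠ P) := by
  have hp : p.Prime := Fact.out
  have hA := X2.UnramifiedLineIntegral.hasseCoeff_integralModelInt_ne_zero_of_mult hp2 hmult
  -- a `p`-torsion point off the integral locus, moved by an inertia element
  obtain ⟨x, y, h, hpP, hx⟩ := exists_prime_zsmul_eq_zero_one_lt_valuation_placeOver p W hp2 hA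
  set P₀ : geomTorsion W (p : ℤ) :=
    ⟨(Affine.Point.some x y h : W.geomPoints), (Submodule.mem_torsionBy_iff (p : ℤ) _).mpr hpP⟩
    with hP₀def
  have hP₀ : (P₀ : W.geomPoints) = Affine.Point.some x y h := rfl
  have hP₀red : WeierstrassCurve.ReducesToZero (placeModel p W)
      (Affine.Point.congrEquiv (placeModel_baseChange p W).symm (P₀ : W.geomPoints)) :=
    (reducesToZero_place_iff_of_eq_some hP₀).mpr hx
  obtain ⟨τ, hτ, hne⟩ :=
    X2.UnramifiedLineIntegral.exists_inertia_smul_ne_of_prime_zsmul_eq_zero_of_one_lt hp2 hA hP₀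
      ((Submodule.mem_torsionBy_iff (p : ℤ) _).mp P₀.2) hx hmem
  -- `Q = τP₀ - P₀ ∈ X ∩ E₁`, non-zero
  set Q : geomTorsion W (p : ℤ) := τ • P₀ - P₀ with hQdef
  have hQX : Q ∈ X := hXsub τ hτ P₀
  have hQ0 : Q ≠ 0 := by
    intro h0
    apply hne
    have h1 := congrArg Subtype.val h0
    rw [hQdef, AddSubgroupClass.coe_sub, AddSubgroup.torsionBy.coe_smul, ZeroMemClass.coe_zero,
      sub_eq_zero] at h1
    exact h1
  have hQred : WeierstrassCurve.ReducesToZero (placeModel p W)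
      (Affine.Point.congrEquiv (placeModel_baseChange p W).symm (Q : W.geomPoints)) := by
    rw [hQdef, AddSubgroupClass.coe_sub, AddSubgroup.torsionBy.coe_smul]
    exact reducesToZero_place_sub ((reducesToZero_place_smul_iff hmem hτ hP₀).mpr hP₀red) hP₀red
  -- `#X = p` and `X = ℤ Q`
  haveI : Finite (geomTorsion W (p : ℤ)) :=
    Nat.finite_of_card_ne_zero (by rw [Rank1Residual.natCard_geomTorsion W p]; exact pow_ne_zero 2 hp.ne_zero)
  have hle : p ≤ Nat.card X := by
    have h1 := AddSubgroup.card_le_of_le (AddSubgroup.zmultiples_le_of_mem hQX)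
    rwa [Nat.card_zmultiples, addOrderOf_eq_prime
      (X2.ResidualDevissageLine.nsmul_eq_zero_of_mem_geomTorsion Q) hQ0] at h1
  have hXp : Nat.card X = p := le_antisymm hXcard hle
  have hXQ : X = AddSubgroup.zmultiples Q := eq_zmultiples_of_card_eq hXp hQX hQ0
  refine ⟨hXp, fun P hP ↦ ?_, ?_⟩
  · rw [hXQ, AddSubgroup.mem_zmultiples_iff] at hP
    obtain ⟨m, rfl⟩ := hP
    rw [AddSubgroupClass.coe_zsmul]
    exact reducesToZero_place_zsmul hQred m
  · -- `Q` is off the integral locus, hence moved by inertia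
    have hQ0' : (Q : W.geomPoints) ≠ 0 := fun h0 ↦ hQ0 (Subtype.ext h0)
    obtain ⟨x', y', h', hQeq⟩ := exists_eq_some_of_ne_zero hQ0'
    have hx' : 1 < (placeOver p).valuation x' := (reducesToZero_place_iff_of_eq_some hQeq).mp hQred
    obtain ⟨σ, hσ, hσne⟩ :=
      X2.UnramifiedLineIntegral.exists_inertia_smul_ne_of_prime_zsmul_eq_zero_of_one_lt hp2 hA hQeq
        ((Submodule.mem_torsionBy_iff (p : ℤ) _).mp Q.2) hx' hmem
    exact ⟨σ, hσ, Q, hQX, fun heq ↦ hσne (by rw [← AddSubgroup.torsionBy.coe_smul, heq])⟩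

variable (W p) in
/-- **(hL) at an odd multiplicative prime, at every prime of `\bar ℤ` above `p`, WITHOUT the Tate
curve.** For `E/ℚ` globally minimal with multiplicative reduction at the odd prime `p`: at every prime
`𝔓` above `p` there is a line `L ≤ E[p]` of order `p` with `(σ - 1)E[p] ⊆ L` for all `σ ∈ I_𝔓` and
some `σ ∈ I_𝔓` moving a point of `L`. Same conclusion as `X2.exists_tateLine`, which takes the Tate
uniformisation named facts `hT`, `hT'` (Silverman *ATAEC* V.5.3/5.4); here from Serre's `(χ *; 0 1)`
shape (§1.12, tree, on the Tate FORM of invariant `j`) and §2, transported to every prime above `p` by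
conjugation (`X2.forall_primesAbove_of_line`). [cite: SerreInventiones1972, §1.12 (Cor. of Prop. 13)]
[cite: GreenbergVatsal2000, §2 pp. 14–15] -/
theorem exists_inertiaLine_of_mult (hp2 : p ≠ 2) (hmult : W.HasMultiplicativeReductionAtPrime p) :
    ∀ (v : HeightOneSpectrum (𝓞 ℚ)), (p : 𝓞 ℚ) ∈ v.asIdeal → ∀ 𝔓 ∈ v.primesAbove,
      ∃ L : AddSubgroup (geomTorsion W (p : ℤ)), Nat.card L = p ∧
        (∀ σ ∈ 𝔓.inertia (absoluteGaloisGroup ℚ), ∀ P : geomTorsion W (p : ℤ), σ • P - P ∈ L) ∧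
        (∃ σ ∈ 𝔓.inertia (absoluteGaloisGroup ℚ), ∃ P ∈ L, σ • P ≠ P) := by
  intro v hv 𝔓 h𝔓
  have hp : p.Prime := Fact.out
  have hvp : (primesEquiv v : ℕ) = p := primesEquiv_eq_of_natCast_mem hp hv
  obtain ⟨𝔓₁, hmem, h𝔓₁⟩ := exists_ideal_placeOver p hvp
  obtain ⟨X, hXcard, hXsub⟩ := W.exists_addSubgroup_card_le_of_hasMultiplicativeReductionAt hp2 hv
    (hasMultiplicativeReductionAt_of_natCast_mem hmult hv) h𝔓₁
  obtain ⟨hXp, -, hmov⟩ :=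
    card_eq_and_reducesToZero_and_exists_smul_ne_of_inertiaLine hp2 hmult hmem hXcard hXsub
  exact X2.forall_primesAbove_of_line h𝔓₁ hXp hXsub hmov 𝔓 h𝔓

/-- **Every non-zero point of an inertia line at the place's prime has non-`𝔓`-integral abscissa**
(multiplicative odd `p`; `L ≤ E[p]` any subgroup of order `≤ p` with `(τ - 1)E[p] ⊆ L` for
`τ ∈ I_𝔓`, `𝔓` the prime of the place `placeOver p`): the points of the canonical subgroup are off
the integral locus (Serre 1972 §1.11: `|x|_𝔓 = |p|^{-2/(p-1)}`). [cite: SerreInventiones1972, §1.11 (Prop. 11)] -/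
theorem one_lt_valuation_of_mem_inertiaLine (hp2 : p ≠ 2)
    (hmult : W.HasMultiplicativeReductionAtPrime p)
    {𝔓 : Ideal (absIntegers (𝓞 ℚ) ℚ)}
    (hmem : ∀ z : absIntegers (𝓞 ℚ) ℚ, z ∈ 𝔓 ↔ (z : AlgebraicClosure ℚ) ∈ (placeOver p).nonunits)
    {L : AddSubgroup (geomTorsion W (p : ℤ))} (hLcard : Nat.card L ≤ p)
    (hLsub : ∀ τ ∈ 𝔓.inertia (absoluteGaloisGroup ℚ), ∀ P : geomTorsion W (p : ℤ), τ • P - P ∈ L)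
    {P : geomTorsion W (p : ℤ)} (hPL : P ∈ L)
    {x y : AlgebraicClosure ℚ} {h : (W.baseChange (AlgebraicClosure ℚ)).toAffine.Nonsingular x y}
    (hP : (P : W.geomPoints) = Affine.Point.some x y h) :
    1 < (placeOver p).valuation x :=
  (reducesToZero_place_iff_of_eq_some hP).mp
    ((card_eq_and_reducesToZero_and_exists_smul_ne_of_inertiaLine hp2 hmult hmem hLcard hLsub).2.1 P hPL)


end KernelDisc

end Summit.BirchSwinnertonDyer.Rank1Residual

end
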